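import Mathlib
import HarnessLib
import Summits.ValiantsHypothesis.ValiantsHypothesis.Theorems.LacunarySymmetroidMatrixDescartesOsculationLawGPArcResultant
import Summits.ValiantsHypothesis.ValiantsHypothesis.Theorems.LacunarySymmetroidMatrixDescartesOsculationLawGPGenericCoprime
import Summits.ValiantsHypothesis.ValiantsHypothesis.Theorems.LacunarySymmetroidMatrixDescartesOsculationLawUniformGeneric

/-!
# ValiantsHypothesis / LacunarySymmetroid — crux `MatrixDescartes` (stmt-ValiantsHypothesis-18050, V1),
# line `Cruxes/MatrixDescartes/Lines/osculation_law.lean` («osculation-law»), stub `stub_recursion`, ROUTE′ density residue: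
# TRANSPORT OF ARC AVOIDANCE ALONG A SEGMENT (the (a1)/(a2) provider engine)

The two arc-avoidance conditions of the node family `N′` («no osculation point of the node curve `Φ_ε` on the arc
`b = C·t^N`») are transported along a density segment `ε ↦ Φ_ε = (map ev_ε) Ψ` (`Ψ` a master curve over `ℝ[ε]`) from
ONE good parameter `ε₁` (the witness end) to all but finitely many `ε`:

* `arc_map` — restricting to the arc commutes with specialising the parameter:
  `arc_C (map φ Ψ) = (arc Ψ).map φ` (the arc over `ℝ[ε]` has coefficient `C (C C)`);
* `coeff_det_pencil_arc`, `leadingCoeff_det_pencil_arc` — the `t`-leading coefficient of an arc-restricted determinantal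
  node curve `det(Σ_l t^(d l) 𝔖_l + (c t^N)•B)` with `d l < N` is `c^|ι| · det B` (Leibniz expansion), so the
  `lc_t ≠ 0` input of the transport is a determinant at the witness;
* ★ `arc_osc_cofinite_of_master` — if `lc_t(arc Ψ)(ε₁) ≠ 0` and `arc_C Φ_(ε₁)`, `arc_C H(Φ_(ε₁))` are coprime, then off a
  FINITE set of `ε` no point of `{t > 0, b > 0, Φ_ε = 0, H(Φ_ε) = 0}` lies on `b = C·t^N`
  (val-port-3 g1's `GPDensity.finite_setOf_exists_common_root_map₂` + val-lit-p5 g12's `OsculationUniform.logH_map`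
  + `eval_aeval_arc`).

Honest framing: helper lemmas (glue) toward the OPEN stub `stub_recursion`; the LAW `stub_osculationLaw`, `MatrixDescartes`
(18050) and `VP ≠ VNP` are NOT proved.  No definitions, no named facts.
-/

-- `Summit.ValiantsHypothesis.ValiantsHypothesis.…` is the tree's mandated single-conjunct layout (Sub = Summit).
set_option linter.dupNamespace false

noncomputable section

namespace Summit.ValiantsHypothesis.ValiantsHypothesis.Theorems.LacunarySymmetroidMatrixDescartes

open Polynomial

namespace OsculationGeneric

/-! ### Naturality of the arc restriction in the parameter -/

/-- Restricting to the arc `b = C·t^N` commutes with specialising the coefficients: for `φ : A →+* ℝ` with `φ c = C`,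
`arc_C (map φ Ψ) = (arc_c Ψ).map φ`. [folklore] -/
theorem arc_map {A : Type*} [CommRing A] (Ψ : MvPolynomial (Fin 2) A) (φ : A →+* ℝ) (c : A) (C : ℝ)
    (hc : φ c = C) (N : ℕ) :
    (MvPolynomial.aeval (![Polynomial.X, Polynomial.C C * Polynomial.X ^ N] : Fin 2 → ℝ[X])) (MvPolynomial.map φ Ψ) =
      (MvPolynomial.aeval (![Polynomial.X, Polynomial.C c * Polynomial.X ^ N] : Fin 2 → A[X]) Ψ).map φ := by
  set F : MvPolynomial (Fin 2) A →+* ℝ[X] :=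
    (MvPolynomial.aeval (![Polynomial.X, Polynomial.C C * Polynomial.X ^ N] : Fin 2 → ℝ[X])).toRingHom.comp (MvPolynomial.map φ) with hF
  set G : MvPolynomial (Fin 2) A →+* ℝ[X] :=
    (Polynomial.mapRingHom φ).comp
      (MvPolynomial.aeval (![Polynomial.X, Polynomial.C c * Polynomial.X ^ N] : Fin 2 → A[X])).toRingHom with hG
  have hFG : F = G := by
    refine MvPolynomial.ringHom_ext (fun a => ?_) (fun i => ?_)
    · simp [hF, hG, Polynomial.algebraMap_eq]
    · fin_cases i <;> simp [hF, hG, hc]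
  have := congr_arg (fun ψ : MvPolynomial (Fin 2) A →+* ℝ[X] => ψ Ψ) hFG
  simpa [hF, hG] using this

/-! ### The `t`-leading coefficient of an arc-restricted determinantal node curve -/

/-- **Leibniz bookkeeping.**  For exponents `d l < N`, constant matrices `𝔖_l`, `B` and a scalar `c` over any commutative
ring: `det(Σ_l X^(d l)•𝔖_l + (c X^N)•B)` has `natDegree ≤ |ι|·N` and its coefficient of `X^(|ι|·N)` is `c^|ι|·det B`.
[folklore] -/
theorem coeff_det_pencil_arc {A : Type*} [CommRing A] {ι : Type*} [Fintype ι] [DecidableEq ι] {K : ℕ}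
    (d : Fin K → ℕ) (N : ℕ) (hd : ∀ l, d l < N) (𝔖 : Fin K → Matrix ι ι A) (B : Matrix ι ι A) (c : A) :
    (∑ l, (Polynomial.X : A[X]) ^ d l • (𝔖 l).map Polynomial.C +
        (Polynomial.C c * Polynomial.X ^ N) • B.map Polynomial.C).det.natDegree ≤ Fintype.card ι * N ∧
    (∑ l, (Polynomial.X : A[X]) ^ d l • (𝔖 l).map Polynomial.C +
        (Polynomial.C c * Polynomial.X ^ N) • B.map Polynomial.C).det.coeff (Fintype.card ι * N) =
      c ^ Fintype.card ι * B.det := by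
  classical
  set P := ∑ l, (Polynomial.X : A[X]) ^ d l • (𝔖 l).map Polynomial.C +
        (Polynomial.C c * Polynomial.X ^ N) • B.map Polynomial.C with hP
  have hentry : ∀ i j, P i j = ∑ l, Polynomial.C (𝔖 l i j) * Polynomial.X ^ d l + Polynomial.C (c * B i j) * Polynomial.X ^ N := by
    intro i j
    simp only [hP, Matrix.add_apply, Matrix.sum_apply, Matrix.smul_apply, Matrix.map_apply, smul_eq_mul, map_mul]
    congr 1
    · exact Finset.sum_congr rfl fun l _ => by ring
    · ring
  have hdeg : ∀ i j, (P i j).natDegree ≤ N := by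
    intro i j
    rw [hentry]
    refine (Polynomial.natDegree_add_le _ _).trans (max_le ?_ ?_)
    · refine Polynomial.natDegree_sum_le_of_forall_le _ _ fun l _ => ?_
      exact (Polynomial.natDegree_C_mul_X_pow_le _ _).trans (hd l).le
    · exact Polynomial.natDegree_C_mul_X_pow_le _ _
  have hcoeff : ∀ i j, (P i j).coeff N = c * B i j := by
    intro i j
    rw [hentry, Polynomial.coeff_add, Polynomial.finsetSum_coeff, Polynomial.coeff_C_mul_X_pow, if_pos rfl,
      Finset.sum_eq_zero, zero_add]
    intro l _
    rw [Polynomial.coeff_C_mul_X_pow]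
    exact if_neg (hd l).ne'
  have hterm : ∀ σ : Equiv.Perm ι, (∏ i, P (σ i) i).natDegree ≤ Fintype.card ι * N := fun σ =>
    (Polynomial.natDegree_prod_le _ _).trans (by
      calc ∑ i, (P (σ i) i).natDegree ≤ ∑ _i : ι, N := Finset.sum_le_sum fun i _ => hdeg _ _
        _ = Fintype.card ι * N := by rw [Finset.sum_const, smul_eq_mul, Finset.card_univ])
  rw [Matrix.det_apply', Matrix.det_apply']
  constructor
  · refine Polynomial.natDegree_sum_le_of_forall_le _ _ fun σ _ => ?_
    rw [← Polynomial.C_eq_intCast]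
    exact (Polynomial.natDegree_C_mul_le _ _).trans (hterm σ)
  · rw [Polynomial.finsetSum_coeff, Finset.mul_sum]
    refine Finset.sum_congr rfl fun σ _ => ?_
    rw [← Polynomial.C_eq_intCast, Polynomial.coeff_C_mul, ← Finset.card_univ,
      Polynomial.coeff_prod_of_natDegree_le Finset.univ _ N (fun i _ => hdeg _ _)]
    simp_rw [hcoeff]
    rw [Finset.prod_mul_distrib, Finset.prod_const, Finset.card_univ]
    ring

/-- Hence, when `c^|ι|·det B ≠ 0`, the leading coefficient IS `c^|ι|·det B` (and the degree is `|ι|·N`). [folklore] -/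
theorem leadingCoeff_det_pencil_arc {A : Type*} [CommRing A] {ι : Type*} [Fintype ι] [DecidableEq ι] {K : ℕ}
    (d : Fin K → ℕ) (N : ℕ) (hd : ∀ l, d l < N) (𝔖 : Fin K → Matrix ι ι A) (B : Matrix ι ι A) (c : A)
    (hc : c ^ Fintype.card ι * B.det ≠ 0) :
    (∑ l, (Polynomial.X : A[X]) ^ d l • (𝔖 l).map Polynomial.C +
        (Polynomial.C c * Polynomial.X ^ N) • B.map Polynomial.C).det.natDegree = Fintype.card ι * N ∧
    (∑ l, (Polynomial.X : A[X]) ^ d l • (𝔖 l).map Polynomial.C +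
        (Polynomial.C c * Polynomial.X ^ N) • B.map Polynomial.C).det.leadingCoeff = c ^ Fintype.card ι * B.det := by
  obtain ⟨hdeg, hco⟩ := coeff_det_pencil_arc d N hd 𝔖 B c
  have hnat : (∑ l, (Polynomial.X : A[X]) ^ d l • (𝔖 l).map Polynomial.C +
        (Polynomial.C c * Polynomial.X ^ N) • B.map Polynomial.C).det.natDegree = Fintype.card ι * N :=
    le_antisymm hdeg (Polynomial.le_natDegree_of_ne_zero (by rw [hco]; exact hc))
  exact ⟨hnat, by rw [Polynomial.leadingCoeff, hnat, hco]⟩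

/-! ### The transport -/

/-- **Arc avoidance is cofinite along a segment.**  `Ψ` a master curve over `ℝ[ε]`, `Φ_ε = map ev_ε Ψ`.  If at one
parameter `ε₁` the `t`-leading coefficient of the arc restriction of `Ψ` does not vanish and the arc restrictions of
`Φ_(ε₁)` and `H(Φ_(ε₁))` are coprime, then for all `ε` off a finite set no point of the osculation-type set
`{t > 0, b > 0, Φ_ε = 0, H(Φ_ε) = 0}` lies on the arc `b = C·t^N`. [folklore] -/
theorem arc_osc_cofinite_of_master (Ψ : MvPolynomial (Fin 2) ℝ[X]) (C : ℝ) (N : ℕ) (ε₁ : ℝ)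
    (hlc : ((MvPolynomial.aeval (![Polynomial.X, Polynomial.C (Polynomial.C C) * Polynomial.X ^ N] : Fin 2 → ℝ[X][X])) Ψ).leadingCoeff.eval ε₁ ≠ 0)
    (hcop : IsCoprime ((MvPolynomial.aeval (![Polynomial.X, Polynomial.C C * Polynomial.X ^ N] : Fin 2 → ℝ[X])) (MvPolynomial.map (Polynomial.evalRingHom ε₁) Ψ))
      ((MvPolynomial.aeval (![Polynomial.X, Polynomial.C C * Polynomial.X ^ N] : Fin 2 → ℝ[X]))
        (MvPolynomial.X 0 * MvPolynomial.pderiv 0 (MvPolynomial.X 0 * MvPolynomial.pderiv 0 (MvPolynomial.map (Polynomial.evalRingHom ε₁) Ψ))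
            * (MvPolynomial.X 1 * MvPolynomial.pderiv 1 (MvPolynomial.map (Polynomial.evalRingHom ε₁) Ψ)) ^ 2
          - 2 * (MvPolynomial.X 0 * MvPolynomial.pderiv 0 (MvPolynomial.X 1 * MvPolynomial.pderiv 1 (MvPolynomial.map (Polynomial.evalRingHom ε₁) Ψ)))
            * (MvPolynomial.X 0 * MvPolynomial.pderiv 0 (MvPolynomial.map (Polynomial.evalRingHom ε₁) Ψ)) * (MvPolynomial.X 1 * MvPolynomial.pderiv 1 (MvPolynomial.map (Polynomial.evalRingHom ε₁) Ψ))
          + MvPolynomial.X 1 * MvPolynomial.pderiv 1 (MvPolynomial.X 1 * MvPolynomial.pderiv 1 (MvPolynomial.map (Polynomial.evalRingHom ε₁) Ψ))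
            * (MvPolynomial.X 0 * MvPolynomial.pderiv 0 (MvPolynomial.map (Polynomial.evalRingHom ε₁) Ψ)) ^ 2))) :
    ∃ B : Set ℝ, B.Finite ∧ ∀ ε : ℝ, ε ∉ B →
      ∀ p ∈ {p : Fin 2 → ℝ | 0 < p 0 ∧ 0 < p 1 ∧ MvPolynomial.eval p (MvPolynomial.map (Polynomial.evalRingHom ε) Ψ) = 0 ∧
        MvPolynomial.eval p
          (MvPolynomial.X 0 * MvPolynomial.pderiv 0 (MvPolynomial.X 0 * MvPolynomial.pderiv 0 (MvPolynomial.map (Polynomial.evalRingHom ε) Ψ))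
            * (MvPolynomial.X 1 * MvPolynomial.pderiv 1 (MvPolynomial.map (Polynomial.evalRingHom ε) Ψ)) ^ 2
          - 2 * (MvPolynomial.X 0 * MvPolynomial.pderiv 0 (MvPolynomial.X 1 * MvPolynomial.pderiv 1 (MvPolynomial.map (Polynomial.evalRingHom ε) Ψ)))
            * (MvPolynomial.X 0 * MvPolynomial.pderiv 0 (MvPolynomial.map (Polynomial.evalRingHom ε) Ψ)) * (MvPolynomial.X 1 * MvPolynomial.pderiv 1 (MvPolynomial.map (Polynomial.evalRingHom ε) Ψ))
          + MvPolynomial.X 1 * MvPolynomial.pderiv 1 (MvPolynomial.X 1 * MvPolynomial.pderiv 1 (MvPolynomial.map (Polynomial.evalRingHom ε) Ψ))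
            * (MvPolynomial.X 0 * MvPolynomial.pderiv 0 (MvPolynomial.map (Polynomial.evalRingHom ε) Ψ)) ^ 2) = 0},
        p 1 ≠ C * p 0 ^ N := by
  -- the two bivariate polynomials (outer variable `t`, coefficients in `ε`)
  set F : ℝ[X][X] := (MvPolynomial.aeval (![Polynomial.X, Polynomial.C (Polynomial.C C) * Polynomial.X ^ N] : Fin 2 → ℝ[X][X])) Ψ with hFdef
  set G : ℝ[X][X] := (MvPolynomial.aeval (![Polynomial.X, Polynomial.C (Polynomial.C C) * Polynomial.X ^ N] : Fin 2 → ℝ[X][X]))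
        (MvPolynomial.X 0 * MvPolynomial.pderiv 0 (MvPolynomial.X 0 * MvPolynomial.pderiv 0 Ψ)
            * (MvPolynomial.X 1 * MvPolynomial.pderiv 1 Ψ) ^ 2
          - 2 * (MvPolynomial.X 0 * MvPolynomial.pderiv 0 (MvPolynomial.X 1 * MvPolynomial.pderiv 1 Ψ))
            * (MvPolynomial.X 0 * MvPolynomial.pderiv 0 Ψ) * (MvPolynomial.X 1 * MvPolynomial.pderiv 1 Ψ)
          + MvPolynomial.X 1 * MvPolynomial.pderiv 1 (MvPolynomial.X 1 * MvPolynomial.pderiv 1 Ψ)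
            * (MvPolynomial.X 0 * MvPolynomial.pderiv 0 Ψ) ^ 2) with hGdef
  have hF : ∀ ε : ℝ, F.map (Polynomial.evalRingHom ε) = (MvPolynomial.aeval (![Polynomial.X, Polynomial.C C * Polynomial.X ^ N] : Fin 2 → ℝ[X])) (MvPolynomial.map (Polynomial.evalRingHom ε) Ψ) := fun ε =>
    (arc_map Ψ (Polynomial.evalRingHom ε) (Polynomial.C C) C (by simp) N).symm
  have hG : ∀ ε : ℝ, G.map (Polynomial.evalRingHom ε) = (MvPolynomial.aeval (![Polynomial.X, Polynomial.C C * Polynomial.X ^ N] : Fin 2 → ℝ[X]))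
        (MvPolynomial.X 0 * MvPolynomial.pderiv 0 (MvPolynomial.X 0 * MvPolynomial.pderiv 0 (MvPolynomial.map (Polynomial.evalRingHom ε) Ψ))
            * (MvPolynomial.X 1 * MvPolynomial.pderiv 1 (MvPolynomial.map (Polynomial.evalRingHom ε) Ψ)) ^ 2
          - 2 * (MvPolynomial.X 0 * MvPolynomial.pderiv 0 (MvPolynomial.X 1 * MvPolynomial.pderiv 1 (MvPolynomial.map (Polynomial.evalRingHom ε) Ψ)))
            * (MvPolynomial.X 0 * MvPolynomial.pderiv 0 (MvPolynomial.map (Polynomial.evalRingHom ε) Ψ)) * (MvPolynomial.X 1 * MvPolynomial.pderiv 1 (MvPolynomial.map (Polynomial.evalRingHom ε) Ψ))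
          + MvPolynomial.X 1 * MvPolynomial.pderiv 1 (MvPolynomial.X 1 * MvPolynomial.pderiv 1 (MvPolynomial.map (Polynomial.evalRingHom ε) Ψ))
            * (MvPolynomial.X 0 * MvPolynomial.pderiv 0 (MvPolynomial.map (Polynomial.evalRingHom ε) Ψ)) ^ 2) := fun ε => by
    rw [OsculationUniform.logH_map, hGdef]
    exact (arc_map _ (Polynomial.evalRingHom ε) (Polynomial.C C) C (by simp) N).symm
  have hfin := GPDensity.finite_setOf_exists_common_root_map₂ F G ε₁ hlc (by rw [hF, hG]; exact hcop) (fun _ t => 0 < t)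
  refine ⟨_, hfin, fun ε hε p hp harc => hε ?_⟩
  obtain ⟨h0, -, hΦ, hH⟩ := hp
  have hp01 : p = ![p 0, C * p 0 ^ N] := by
    ext i
    fin_cases i
    · rfl
    · exact harc
  refine ⟨p 0, h0, ?_, ?_⟩
  · rw [hF, eval_aeval_arc, ← hp01]; exact hΦ
  · rw [hG, eval_aeval_arc, ← hp01]; exact hH

end OsculationGeneric

end Summit.ValiantsHypothesis.ValiantsHypothesis.Theorems.LacunarySymmetroidMatrixDescartes

end
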